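/-
Origin: expansion seat `planner-pub-hodgecm-pv05-g6-0`, handover #8 2026-08-18T12:21:40Z (`HOME/pub-hodgecm-pv05-g6/lean/Pv05g6/FockKFiniteDense.lean`, md5 56313460, 157 lines);
landed by the gen-8 packager in gate run 29 as `HodgeCM/PerL34/FockKFiniteDense.lean` (import ^import Pv05g6\.FockClosedInvariant[ \t]*$→import HodgeCM.PerL34.FockClosedInvariant ×1).
-/
import Summits.HodgeConjecture.HodgeCM.PerL34.FockClosedInvariant

set_option autoImplicit false

/-!
# `K`-finite vectors are dense in every closed invariant subspace; the classification in the Schrödinger model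

Node-style kernel file #8 of seat `pub-hodgecm-pv05-g6` (Fock–Hermite genuine-`L²` lane).  Additive: it imports only
`FockClosedInvariant` (#7); no `Literature`, no `HarnessLib`, no cited fact.

## What is proved

* `closed_unitaryStable_eq_closure_span_polynomial` / `…_span_kFinite`: a CLOSED `U(σ)`-stable submodule `V` of
  the genuine `L²` Fock space `FockL2 σ` is the closure of the span of the POLYNOMIAL vectors it contains —
  equivalently (#2 `isUnitaryFinite_iff_isPolynomialVec`) of its `U(σ)`-FINITE vectors: the `K`-finite vectors of
  a closed invariant subspace are dense in it (`K = U(σ)` compact, acting by `ν₀ = fockRep`).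
* `hermSpan D = span {h_α : |α| ∈ D} ⊂ L²(ℝ^σ)`, `map_bargmann_hermSpan : B (hermSpan D) = degSpan D`,
  `mem_closure_hermSpan_iff : f ∈ closure (hermSpan D) ↔ B f ∈ closure (degSpan D)`.
* **`closed_schrodingerStable_iff`**: a closed submodule `V ≤ L²(ℝ^σ)` is stable under all the transported
  operators `schrodingerU U = B⁻¹ ν₀(U) B` (`U ∈ U(σ)`) iff `V = closure (hermSpan D)` for some `D ⊆ ℕ` — the
  Schrödinger-model form of #7 `closed_unitaryStable_iff`, transported through the Bargmann unitary
  `bargmann : L²(ℝ^σ) ≃ₗᵢ[ℂ] FockL2 σ` (tree file `FockBargmann`), which is a homeomorphism onto.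

## Published statements (quoted verbatim from the materialised text; line numbers of the page files `pNNNN.txt`)

[Fo89] G. B. Folland, *Harmonic Analysis in Phase Space*, Annals of Mathematics Studies 122, Princeton UP 1989.
* p. 183, line 1, the one-dimensional case of `closed_schrodingerStable_iff`: "(4.76) Proposition. Let
  $K = Sp \cap O(2n)$ . The only one-dimensional subspaces of  $L^2(\mathbf{R}^n)$  that are invariant under the
  operators  $\mu(\mathcal{A})$  for all  $\mathcal{A} \in K$  are the spans of the Hermite functions  $h_j$
  $(0 \le j \le \infty)$  when n = 1, and the span of  $\gamma(x) = e^{-\pi x^2}$  when n > 1." (kernel form: #4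
  `schrodingerStable_line_iff`; as throughout this lane `μ(𝒜)`, `𝒜 ∈ K ≅ U(n)`, is realised as
  `schrodingerU U = B⁻¹ν₀(U)B`, i.e. Folland's `μ(𝒜) = B⁻¹ν(𝒜_c)B` of p. 162 line 5 with the scalar `det^{-1/2}`
  discarded as on p. 162 line 1 — a scalar changes no invariant subspace.)
* p. 182, line 39: "Moreover, each  $\mathcal{P}_k$  is irreducible under the action of U(n)." and p. 182, line 35:
  "the Fock space  $\mathcal{F}_n$  is the orthogonal direct sum  $\bigoplus_{0}^{\infty} \mathcal{P}_k$" — the two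
  inputs of #7, kernel-proved in #6 / tree `FockSpaceL2` + #3, not cited.

Density of `K`-finite vectors in closed invariant subspaces is the standard corollary; it is recorded because
invariant-subspace statements about the oscillator representation are USED downstream in `K`-finite form.
-/

noncomputable section

open MeasureTheory Complex MvPolynomial Matrix Filter Topology
open scoped Real ComplexConjugate InnerProductSpace

namespace HodgeCM.PerL34.Fock.Hermite

variable {σ : Type*} [Fintype σ] [DecidableEq σ]

/-! ## 1. Polynomial = `K`-finite vectors are dense in every closed invariant subspace -/

omit [DecidableEq σ] in
/-- (Ported verbatim from the HodgeCMPerL package; no docstring in the source.) -/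
theorem isPolynomialVec_fockBasis (β : σ →₀ ℕ) : IsPolynomialVec (fockBasis β : FockL2 σ) :=
  ⟨zeta β, by rw [fockToL2_zeta, fockBasis_apply]⟩

/-- A closed `U(σ)`-stable subspace is the closure of the span of its POLYNOMIAL vectors. -/
theorem closed_unitaryStable_eq_closure_span_polynomial {V : Submodule ℂ (FockL2 σ)}
    (hVc : IsClosed (V : Set (FockL2 σ))) (hV : ∀ U : Matrix.unitaryGroup σ ℂ, ∀ x ∈ V, fockRep U x ∈ V) :
    V = (Submodule.span ℂ {x : FockL2 σ | x ∈ V ∧ IsPolynomialVec x}).topologicalClosure := by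
  apply le_antisymm
  · have h := closed_unitaryStable_eq_closure_degSpan hVc hV
    conv_lhs => rw [h]
    refine Submodule.topologicalClosure_mono (Submodule.span_le.mpr ?_)
    rintro _ ⟨β, ⟨x, hxV, hxk, hx0⟩, rfl⟩
    exact Submodule.subset_span
      ⟨degSpan_le_of_unitaryStable hV hxV hxk hx0 (Submodule.subset_span ⟨β, rfl, rfl⟩), isPolynomialVec_fockBasis β⟩
  · exact Submodule.topologicalClosure_minimal _ (Submodule.span_le.mpr fun x hx => hx.1) hVc

/-- **`K`-finite vectors are dense in every closed `U(σ)`-invariant subspace of the Fock space.** -/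
theorem closed_unitaryStable_eq_closure_span_kFinite {V : Submodule ℂ (FockL2 σ)}
    (hVc : IsClosed (V : Set (FockL2 σ))) (hV : ∀ U : Matrix.unitaryGroup σ ℂ, ∀ x ∈ V, fockRep U x ∈ V) :
    V = (Submodule.span ℂ {x : FockL2 σ | x ∈ V ∧ IsUnitaryFinite x}).topologicalClosure := by
  have hset : {x : FockL2 σ | x ∈ V ∧ IsUnitaryFinite x} = {x : FockL2 σ | x ∈ V ∧ IsPolynomialVec x} := by
    ext x
    simp only [Set.mem_setOf_eq, isUnitaryFinite_iff_isPolynomialVec]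
  rw [hset]
  exact closed_unitaryStable_eq_closure_span_polynomial hVc hV

/-! ## 2. The Schrödinger model `L²(ℝ^σ)` -/

/-- `hermSpan D = span {h_α : |α| ∈ D}`, the Hermite pieces of the degrees in `D`. -/
def hermSpan (D : Set ℕ) : Submodule ℂ (Lp ℂ 2 (volume : Measure (σ → ℝ))) :=
  Submodule.span ℂ ((fun α : σ →₀ ℕ => hermiteL2 α) '' {α | mdeg α ∈ D})

/-- (Ported verbatim from the HodgeCMPerL package; no docstring in the source.) -/
theorem hermSpan_singleton (k : ℕ) : hermSpan ({k} : Set ℕ) = hermDegSpan (σ := σ) k := rfl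

/-- `B (hermSpan D) = degSpan D`. -/
theorem map_bargmann_hermSpan (D : Set ℕ) :
    (hermSpan D).map (bargmann (σ := σ)).toLinearEquiv.toLinearMap = degSpan D := by
  rw [hermSpan, degSpan, Submodule.map_span, ← Set.image_comp]
  congr 1
  refine Set.image_congr fun α _ => ?_
  show bargmann (hermiteL2 α) = (fockBasis α : FockL2 σ)
  rw [bargmann_hermiteL2, fockBasis_apply]

/-- (Ported verbatim from the HodgeCMPerL package; no docstring in the source.) -/
theorem image_bargmann_hermSpan (D : Set ℕ) :
    (bargmann (σ := σ)) '' (↑(hermSpan (σ := σ) D) : Set (Lp ℂ 2 (volume : Measure (σ → ℝ)))) =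
      (↑(degSpan (σ := σ) D) : Set (FockL2 σ)) := by
  rw [← map_bargmann_hermSpan D, Submodule.map_coe]
  rfl

/-- `f ∈ closure (hermSpan D) ↔ B f ∈ closure (degSpan D)` (`B` is a homeomorphism onto). -/
theorem mem_closure_hermSpan_iff (D : Set ℕ) (f : Lp ℂ 2 (volume : Measure (σ → ℝ))) :
    f ∈ (hermSpan D).topologicalClosure ↔ bargmann f ∈ (degSpan (σ := σ) D).topologicalClosure := by
  rw [← SetLike.mem_coe, ← SetLike.mem_coe, Submodule.topologicalClosure_coe, Submodule.topologicalClosure_coe,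
    ← image_bargmann_hermSpan, ← LinearIsometryEquiv.coe_toHomeomorph, ← Homeomorph.image_closure,
    (bargmann (σ := σ)).toHomeomorph.injective.mem_set_image]

/-- (Ported verbatim from the HodgeCMPerL package; no docstring in the source.) -/
theorem bargmann_schrodingerU (U : Matrix.unitaryGroup σ ℂ) (f : Lp ℂ 2 (volume : Measure (σ → ℝ))) :
    bargmann (schrodingerU U f) = fockRep U (bargmann f) := by
  rw [schrodingerU_apply, LinearIsometryEquiv.apply_symm_apply]

/-- The closure of a sum of Hermite pieces is stable under every `schrodingerU U`. -/
theorem closure_hermSpan_schrodingerStable (D : Set ℕ) (U : Matrix.unitaryGroup σ ℂ)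
    {f : Lp ℂ 2 (volume : Measure (σ → ℝ))} (hf : f ∈ (hermSpan D).topologicalClosure) :
    schrodingerU U f ∈ (hermSpan D).topologicalClosure := by
  rw [mem_closure_hermSpan_iff] at hf ⊢
  rw [bargmann_schrodingerU]
  exact closure_degSpan_unitaryStable D U hf

/-- **Closed `U(σ)`-invariant subspaces of `L²(ℝ^σ)` in the Schrödinger model of the oscillator representation
= closures of sums of Hermite pieces.** -/
theorem closed_schrodingerStable_iff {V : Submodule ℂ (Lp ℂ 2 (volume : Measure (σ → ℝ)))}
    (hVc : IsClosed (V : Set (Lp ℂ 2 (volume : Measure (σ → ℝ))))) :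
    (∀ U : Matrix.unitaryGroup σ ℂ, ∀ f ∈ V, schrodingerU U f ∈ V) ↔
      ∃ D : Set ℕ, V = (hermSpan D).topologicalClosure := by
  constructor
  · intro hV
    have hmem : ∀ x : FockL2 σ, x ∈ V.map (bargmann (σ := σ)).toLinearEquiv.toLinearMap ↔ bargmann.symm x ∈ V :=
      fun x => Submodule.mem_map_equiv (e := (bargmann (σ := σ)).toLinearEquiv) V
    have hV'c : IsClosed ((V.map (bargmann (σ := σ)).toLinearEquiv.toLinearMap : Submodule ℂ (FockL2 σ)) :
        Set (FockL2 σ)) := by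
      have hcoe : ((V.map (bargmann (σ := σ)).toLinearEquiv.toLinearMap : Submodule ℂ (FockL2 σ)) :
          Set (FockL2 σ)) = (bargmann (σ := σ)).toHomeomorph '' (V : Set (Lp ℂ 2 (volume : Measure (σ → ℝ)))) :=
        Submodule.map_coe _ _
      rw [hcoe, Homeomorph.isClosed_image]
      exact hVc
    have hV's : ∀ U : Matrix.unitaryGroup σ ℂ, ∀ x ∈ V.map (bargmann (σ := σ)).toLinearEquiv.toLinearMap,
        fockRep U x ∈ V.map (bargmann (σ := σ)).toLinearEquiv.toLinearMap := by
      intro U x hx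
      rw [hmem] at hx ⊢
      have h1 : bargmann.symm (fockRep U x) = schrodingerU U (bargmann.symm x) := by
        rw [schrodingerU_apply, LinearIsometryEquiv.apply_symm_apply]
      rw [h1]
      exact hV U _ hx
    obtain ⟨D, hD⟩ := (closed_unitaryStable_iff hV'c).mp hV's
    refine ⟨D, ?_⟩
    ext f
    rw [mem_closure_hermSpan_iff, ← hD, hmem, LinearIsometryEquiv.symm_apply_apply]
  · rintro ⟨D, hD⟩ U f hf
    rw [hD] at hf ⊢
    exact closure_hermSpan_schrodingerStable D U hf

end HodgeCM.PerL34.Fock.Hermite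

end
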